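import Mathlib
/-! # Stub `stub_engineHomogeneous` — crux `TwoProducts` (stmt-ValiantsHypothesis-5906), line `corner-log-linearization`
   The graded-homogeneous rung of the engine: if every factor `u_i`, `v_i` has constant term `1`
   and all its other monomials have the same `ws`-degree `d` (for one positive grading `ws`), then
   every exponent of `D = ∏ u_i - ∏ v_i` has `ws`-degree `r * d` with `1 ≤ r ≤ n` (the constant
   terms cancel).  On one level line `ws₀ x + ws₁ y = c` every linear form is affine in `x`, so a
   strict minimiser of a linear form over `supp D` never lies strictly between two other support
   points of its level: each level carries at most two south-west vertices, whence at most `2n`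
   in total. [folklore] -/
set_option linter.dupNamespace false -- single-conjunct summit: `ValiantsHypothesis.ValiantsHypothesis`
namespace Summit.ValiantsHypothesis.ValiantsHypothesis.Theorems.TwoProducts.Homogeneous
open scoped BigOperators

/-- Interpolation on a level line: if `a`, `m`, `b` have the same `ws`-degree (`ws 1 > 0`) and
`a 0 < m 0 < b 0`, then no linear form is strictly smaller at `m` than at both `a` and `b`.
[folklore] -/
theorem not_strict_min_between (ws : Fin 2 → ℕ) (hws1 : 0 < ws 1) (w : Fin 2 → ℤ)
    (a m b : Fin 2 →₀ ℕ)
    (hla : ws 0 * a 0 + ws 1 * a 1 = ws 0 * m 0 + ws 1 * m 1)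
    (hlb : ws 0 * b 0 + ws 1 * b 1 = ws 0 * m 0 + ws 1 * m 1)
    (ham : a 0 < m 0) (hmb : m 0 < b 0)
    (lta : w 0 * (m 0 : ℤ) + w 1 * (m 1 : ℤ) < w 0 * (a 0 : ℤ) + w 1 * (a 1 : ℤ))
    (ltb : w 0 * (m 0 : ℤ) + w 1 * (m 1 : ℤ) < w 0 * (b 0 : ℤ) + w 1 * (b 1 : ℤ)) : False := by
  have hla' : (ws 0 : ℤ) * (a 0 : ℤ) + (ws 1 : ℤ) * (a 1 : ℤ) =
      (ws 0 : ℤ) * (m 0 : ℤ) + (ws 1 : ℤ) * (m 1 : ℤ) := by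
    exact_mod_cast hla
  have hlb' : (ws 0 : ℤ) * (b 0 : ℤ) + (ws 1 : ℤ) * (b 1 : ℤ) =
      (ws 0 : ℤ) * (m 0 : ℤ) + (ws 1 : ℤ) * (m 1 : ℤ) := by
    exact_mod_cast hlb
  have ham' : (a 0 : ℤ) < (m 0 : ℤ) := by exact_mod_cast ham
  have hmb' : (m 0 : ℤ) < (b 0 : ℤ) := by exact_mod_cast hmb
  have hs : (0 : ℤ) < (ws 1 : ℤ) := by exact_mod_cast hws1
  have hA : (0 : ℤ) < ((b 0 : ℤ) - (m 0 : ℤ)) * (ws 1 : ℤ) := mul_pos (by linarith) hs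
  have hB : (0 : ℤ) < ((m 0 : ℤ) - (a 0 : ℤ)) * (ws 1 : ℤ) := mul_pos (by linarith) hs
  have i1 := mul_lt_mul_of_pos_left lta hA
  have i2 := mul_lt_mul_of_pos_left ltb hB
  have key : (((b 0 : ℤ) - (m 0 : ℤ)) + ((m 0 : ℤ) - (a 0 : ℤ))) *
      ((ws 1 : ℤ) * (w 0 * (m 0 : ℤ) + w 1 * (m 1 : ℤ))) =
      ((b 0 : ℤ) - (m 0 : ℤ)) * ((ws 1 : ℤ) * (w 0 * (a 0 : ℤ) + w 1 * (a 1 : ℤ))) +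
      ((m 0 : ℤ) - (a 0 : ℤ)) * ((ws 1 : ℤ) * (w 0 * (b 0 : ℤ) + w 1 * (b 1 : ℤ))) := by
    linear_combination (-(w 1 * ((b 0 : ℤ) - (m 0 : ℤ)))) * hla' +
      (-(w 1 * ((m 0 : ℤ) - (a 0 : ℤ)))) * hlb'
  nlinarith [i1, i2, key]

/-- Two exponents with the same `ws`-degree (`ws 1 > 0`) and the same first coordinate are equal.
[folklore] -/
theorem eq_of_level_eq_of_apply_zero_eq (ws : Fin 2 → ℕ) (hws1 : 0 < ws 1) (a b : Fin 2 →₀ ℕ)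
    (hl : ws 0 * a 0 + ws 1 * a 1 = ws 0 * b 0 + ws 1 * b 1) (h0 : a 0 = b 0) : a = b := by
  have h1 : a 1 = b 1 := by
    rw [h0] at hl
    exact Nat.eq_of_mul_eq_mul_left hws1 (Nat.add_left_cancel hl)
  ext i
  fin_cases i
  · exact h0
  · exact h1

/-- At most two south-west vertices per level: three pairwise distinct strict minimisers (for
positive integer weights) over a finite set `S` cannot have the same `ws`-degree. [folklore] -/
theorem no_three_sw_on_level (S : Finset (Fin 2 →₀ ℕ)) (ws : Fin 2 → ℕ) (hws1 : 0 < ws 1)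
    (e₁ e₂ e₃ : Fin 2 →₀ ℕ) (h₁₂ : e₁ ≠ e₂) (h₁₃ : e₁ ≠ e₃) (h₂₃ : e₂ ≠ e₃)
    (hl₁₂ : ws 0 * e₁ 0 + ws 1 * e₁ 1 = ws 0 * e₂ 0 + ws 1 * e₂ 1)
    (hl₁₃ : ws 0 * e₁ 0 + ws 1 * e₁ 1 = ws 0 * e₃ 0 + ws 1 * e₃ 1)
    (hsw₁ : ∃ w : Fin 2 → ℤ, 0 < w 0 ∧ 0 < w 1 ∧ (e₁ ∈ S ∧ ∀ e' ∈ S, e' ≠ e₁ →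
      w 0 * (e₁ 0 : ℤ) + w 1 * (e₁ 1 : ℤ) < w 0 * (e' 0 : ℤ) + w 1 * (e' 1 : ℤ)))
    (hsw₂ : ∃ w : Fin 2 → ℤ, 0 < w 0 ∧ 0 < w 1 ∧ (e₂ ∈ S ∧ ∀ e' ∈ S, e' ≠ e₂ →
      w 0 * (e₂ 0 : ℤ) + w 1 * (e₂ 1 : ℤ) < w 0 * (e' 0 : ℤ) + w 1 * (e' 1 : ℤ)))
    (hsw₃ : ∃ w : Fin 2 → ℤ, 0 < w 0 ∧ 0 < w 1 ∧ (e₃ ∈ S ∧ ∀ e' ∈ S, e' ≠ e₃ →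
      w 0 * (e₃ 0 : ℤ) + w 1 * (e₃ 1 : ℤ) < w 0 * (e' 0 : ℤ) + w 1 * (e' 1 : ℤ))) : False := by
  obtain ⟨w₁, -, -, hm₁, hmin₁⟩ := hsw₁
  obtain ⟨w₂, -, -, hm₂, hmin₂⟩ := hsw₂
  obtain ⟨w₃, -, -, hm₃, hmin₃⟩ := hsw₃
  have x₁₂ : e₁ 0 ≠ e₂ 0 := fun h => h₁₂ (eq_of_level_eq_of_apply_zero_eq ws hws1 e₁ e₂ hl₁₂ h)
  have x₁₃ : e₁ 0 ≠ e₃ 0 := fun h => h₁₃ (eq_of_level_eq_of_apply_zero_eq ws hws1 e₁ e₃ hl₁₃ h)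
  have x₂₃ : e₂ 0 ≠ e₃ 0 := fun h =>
    h₂₃ (eq_of_level_eq_of_apply_zero_eq ws hws1 e₂ e₃ (hl₁₂.symm.trans hl₁₃) h)
  have hcases : (e₁ 0 < e₂ 0 ∧ e₂ 0 < e₃ 0) ∨ (e₃ 0 < e₂ 0 ∧ e₂ 0 < e₁ 0) ∨
      (e₂ 0 < e₁ 0 ∧ e₁ 0 < e₃ 0) ∨ (e₃ 0 < e₁ 0 ∧ e₁ 0 < e₂ 0) ∨
      (e₁ 0 < e₃ 0 ∧ e₃ 0 < e₂ 0) ∨ (e₂ 0 < e₃ 0 ∧ e₃ 0 < e₁ 0) := by omega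
  rcases hcases with h | h | h | h | h | h
  · exact not_strict_min_between ws hws1 w₂ e₁ e₂ e₃ hl₁₂ (hl₁₃.symm.trans hl₁₂) h.1 h.2
      (hmin₂ e₁ hm₁ h₁₂) (hmin₂ e₃ hm₃ (Ne.symm h₂₃))
  · exact not_strict_min_between ws hws1 w₂ e₃ e₂ e₁ (hl₁₃.symm.trans hl₁₂) hl₁₂ h.1 h.2
      (hmin₂ e₃ hm₃ (Ne.symm h₂₃)) (hmin₂ e₁ hm₁ h₁₂)
  · exact not_strict_min_between ws hws1 w₁ e₂ e₁ e₃ hl₁₂.symm hl₁₃.symm h.1 h.2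
      (hmin₁ e₂ hm₂ (Ne.symm h₁₂)) (hmin₁ e₃ hm₃ (Ne.symm h₁₃))
  · exact not_strict_min_between ws hws1 w₁ e₃ e₁ e₂ hl₁₃.symm hl₁₂.symm h.1 h.2
      (hmin₁ e₃ hm₃ (Ne.symm h₁₃)) (hmin₁ e₂ hm₂ (Ne.symm h₁₂))
  · exact not_strict_min_between ws hws1 w₃ e₁ e₃ e₂ hl₁₃ (hl₁₂.symm.trans hl₁₃) h.1 h.2
      (hmin₃ e₁ hm₁ h₁₃) (hmin₃ e₂ hm₂ h₂₃)
  · exact not_strict_min_between ws hws1 w₃ e₂ e₃ e₁ (hl₁₂.symm.trans hl₁₃) hl₁₃ h.1 h.2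
      (hmin₃ e₂ hm₂ h₂₃) (hmin₃ e₁ hm₁ h₁₃)

/-- Counting: if every point of `S` has `ws`-degree in `{r * d | 1 ≤ r ≤ n}` (`ws 1 > 0`), then
`S` has at most `2n` strict minimisers for positive integer weights (two per level). [folklore] -/
theorem ncard_sw_le (n : ℕ) (S : Finset (Fin 2 →₀ ℕ)) (ws : Fin 2 → ℕ) (hws1 : 0 < ws 1) (d : ℕ)
    (hlev : ∀ e ∈ S, ∃ r, 1 ≤ r ∧ r ≤ n ∧ ws 0 * e 0 + ws 1 * e 1 = r * d) :
    {e : Fin 2 →₀ ℕ | ∃ w : Fin 2 → ℤ, 0 < w 0 ∧ 0 < w 1 ∧ (e ∈ S ∧ ∀ e' ∈ S, e' ≠ e →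
      w 0 * (e 0 : ℤ) + w 1 * (e 1 : ℤ) < w 0 * (e' 0 : ℤ) + w 1 * (e' 1 : ℤ))}.ncard ≤ 2 * n := by
  classical
  set SW := {e : Fin 2 →₀ ℕ | ∃ w : Fin 2 → ℤ, 0 < w 0 ∧ 0 < w 1 ∧ (e ∈ S ∧ ∀ e' ∈ S, e' ≠ e →
      w 0 * (e 0 : ℤ) + w 1 * (e 1 : ℤ) < w 0 * (e' 0 : ℤ) + w 1 * (e' 1 : ℤ))} with hSW
  have hsub : SW ⊆ ↑S := by
    rintro e ⟨w, -, -, he, -⟩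
    exact he
  have hfin : SW.Finite := S.finite_toSet.subset hsub
  rw [Set.ncard_eq_toFinset_card SW hfin]
  set T := hfin.toFinset with hT
  have hmaps : ∀ e ∈ T, ws 0 * e 0 + ws 1 * e 1 ∈ (Finset.Icc 1 n).image (fun r => r * d) := by
    intro e he
    obtain ⟨r, hr1, hrn, hre⟩ := hlev e (hsub (hfin.mem_toFinset.mp he))
    exact Finset.mem_image.mpr ⟨r, Finset.mem_Icc.mpr ⟨hr1, hrn⟩, hre.symm⟩
  have hfib : ∀ c ∈ (Finset.Icc 1 n).image (fun r => r * d),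
      (T.filter (fun e => ws 0 * e 0 + ws 1 * e 1 = c)).card ≤ 2 := by
    intro c _
    refine not_lt.mp fun h3 => ?_
    obtain ⟨a, ha, b, hb, c', hc, hab, hac, hbc⟩ := Finset.two_lt_card.mp h3
    rw [Finset.mem_filter] at ha hb hc
    exact no_three_sw_on_level S ws hws1 a b c' hab hac hbc (ha.2.trans hb.2.symm)
      (ha.2.trans hc.2.symm) (hfin.mem_toFinset.mp ha.1) (hfin.mem_toFinset.mp hb.1)
      (hfin.mem_toFinset.mp hc.1)
  calc T.card ≤ 2 * ((Finset.Icc 1 n).image (fun r => r * d)).card :=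
        Finset.card_le_mul_card_image_of_maps_to hmaps 2 hfib
    _ ≤ 2 * (Finset.Icc 1 n).card := Nat.mul_le_mul_left 2 Finset.card_image_le
    _ = 2 * n := by simp

/-- Degrees in a product: if every nonzero exponent of every factor `u i` has `ws`-degree `d`,
then every exponent of `∏ i, u i` has `ws`-degree `r * d` for some `r ≤ n`. [folklore] -/
theorem exists_level_of_mem_support_prod (ws : Fin 2 → ℕ) (d : ℕ) :
    ∀ (n : ℕ) (u : Fin n → MvPolynomial (Fin 2) ℂ),
      (∀ i, ∀ τ ∈ (u i).support, τ ≠ 0 → ws 0 * τ 0 + ws 1 * τ 1 = d) →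
      ∀ e ∈ (∏ i, u i).support, ∃ r ≤ n, ws 0 * e 0 + ws 1 * e 1 = r * d := by
  classical
  intro n
  induction n with
  | zero =>
    intro u _ e he
    simp only [Finset.univ_eq_empty, Finset.prod_empty] at he
    have he0 : e = 0 := by
      by_contra h
      rw [MvPolynomial.mem_support_iff, MvPolynomial.coeff_one, if_neg (Ne.symm h)] at he
      exact he rfl
    exact ⟨0, le_refl _, by simp [he0]⟩
  | succ n ih =>
    intro u hu e he
    rw [Fin.prod_univ_succ] at he
    obtain ⟨a, ha, b, hb, rfl⟩ := Finset.mem_add.mp (MvPolynomial.support_mul _ _ he)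
    obtain ⟨r, hr, hrb⟩ := ih (fun i => u i.succ) (fun i => hu i.succ) b hb
    by_cases ha0 : a = 0
    · subst ha0
      refine ⟨r, Nat.le_succ_of_le hr, ?_⟩
      simpa using hrb
    · refine ⟨r + 1, Nat.succ_le_succ hr, ?_⟩
      have hda := hu 0 a ha ha0
      simp only [Finsupp.coe_add, Pi.add_apply]
      linear_combination hda + hrb

/-- STUB `stub_engineHomogeneous` (graded-homogeneous rung of the engine): if all factors `u_i`,
`v_i` have constant term `1` and all their other monomials have one common `ws`-degree `d`
(`ws 0, ws 1 > 0`), then `∏ u_i - ∏ v_i` has at most `2n` south-west vertices (strict minimisers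
of a positive integer weight over its support). [folklore] -/
theorem stub_engineHomogeneous : ∀ (n : ℕ) (u v : Fin n → MvPolynomial (Fin 2) ℂ) (ws : Fin 2 → ℕ) (d : ℕ), 0 < ws 0 → 0 < ws 1 → (∀ i, MvPolynomial.coeff 0 (u i) = 1) → (∀ i, MvPolynomial.coeff 0 (v i) = 1) → (∀ i, ∀ τ ∈ (u i).support, τ ≠ 0 → ws 0 * τ 0 + ws 1 * τ 1 = d) → (∀ i, ∀ τ ∈ (v i).support, τ ≠ 0 → ws 0 * τ 0 + ws 1 * τ 1 = d) → ({e : Fin 2 →₀ ℕ | ∃ w : Fin 2 → ℤ, 0 < w 0 ∧ 0 < w 1 ∧ ((e) ∈ ((∏ i, u i - ∏ i, v i).support) ∧ ∀ e' ∈ ((∏ i, u i - ∏ i, v i).support), e' ≠ (e) → ((w) 0 * ((e) 0 : ℤ) + (w) 1 * ((e) 1 : ℤ)) < ((w) 0 * ((e') 0 : ℤ) + (w) 1 * ((e') 1 : ℤ)))}).ncard ≤ 2 * n := by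
  intro n u v ws d hws0 hws1 hu0 hv0 hu hv
  classical
  have hcu : MvPolynomial.coeff 0 (∏ i, u i) = 1 := by
    rw [← MvPolynomial.constantCoeff_eq, map_prod]
    exact Finset.prod_eq_one fun i _ => hu0 i
  have hcv : MvPolynomial.coeff 0 (∏ i, v i) = 1 := by
    rw [← MvPolynomial.constantCoeff_eq, map_prod]
    exact Finset.prod_eq_one fun i _ => hv0 i
  have hconst : MvPolynomial.coeff 0 (∏ i, u i - ∏ i, v i) = 0 := by
    rw [MvPolynomial.coeff_sub, hcu, hcv, sub_self]
  refine ncard_sw_le n (∏ i, u i - ∏ i, v i).support ws hws1 d fun e he => ?_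
  have he0 : e ≠ 0 := by
    rintro rfl
    exact (MvPolynomial.mem_support_iff.mp he) hconst
  have hpos : 0 < ws 0 * e 0 + ws 1 * e 1 := by
    refine Nat.pos_of_ne_zero fun h => he0 ?_
    have h0 : ws 0 * e 0 = 0 := by omega
    have h1 : ws 1 * e 1 = 0 := by omega
    rw [Nat.mul_eq_zero] at h0 h1
    ext i
    fin_cases i
    · simpa using h0.resolve_left hws0.ne'
    · simpa using h1.resolve_left hws1.ne'
  have hr : ∃ r ≤ n, ws 0 * e 0 + ws 1 * e 1 = r * d := by
    rcases Finset.mem_union.mp (MvPolynomial.support_sub _ _ _ he) with h | h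
    · exact exists_level_of_mem_support_prod ws d n u hu e h
    · exact exists_level_of_mem_support_prod ws d n v hv e h
  obtain ⟨r, hrn, hre⟩ := hr
  refine ⟨r, Nat.pos_of_ne_zero ?_, hrn, hre⟩
  rintro rfl
  rw [hre] at hpos
  simp at hpos

end Summit.ValiantsHypothesis.ValiantsHypothesis.Theorems.TwoProducts.Homogeneous
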